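import Literature.Computability.AlgebraicComplexity.TwoRowTwoRectanglesKronecker
import Literature.Computability.Complexity.OccurrenceObstructionsIPSemigroup
import Literature.Computability.AlgebraicComplexity.BI17SL3InvariantDimensionProofs
import Literature.RepresentationTheory.FiniteGroups.SymmetricGroupCharacterEvaluation
import HarnessLib

/-!
# Two atoms of Bürgisser–Ikenmeyer 2017, Ex. 5.6 for free: `k_8(4) > 0` and `k_12(6) > 0` by
# mixed-format splitting with two-column generators

Topic `Literature/Computability/AlgebraicComplexity`; a PROOFS file (D-0014): theorems only, no
definition, no named fact. Companion of `BI17FundamentalInvariantTensors.lean` (named fact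
`BI2017_ex_5_6`), `BI17KronRectComplementSymmetry.lean` (`BI2017_ex_5_6_of_shape`: the fact is its
shape clause for `7 ≤ m ≤ 12`, i.e. finitely many positivity atoms `0 < k_m(δ)`) — cell val-lit,
row BI2017-B, seat t04 g6.

P. Bürgisser, C. Ikenmeyer, *Fundamental invariants of orbit closures*, J. Algebra 477 (2017)
390–434 = arXiv:1511.02927, §5, Ex. 5.6 (Derksen-program values, held text p. 18): "`E'(8) =
{0, 3, 4, 5, …}`", "`E'(10) = E'(11) = E'(12) = {0, 4, 5, 6, 7, …}`"; here `k_m(δ) = g(m × δ, m × δ,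
m × δ)` is the tree's `kronRect ℂ m δ` and `E(m) = {mδ : k_m(δ) > 0}`
(`genericTensorDegreeMonoid_eq_kronRect`).

## The method (mixed-format splitting)

By the transposition property, `k_m(δ) = g((δ^m), (δ^m)ᵀ, (δ^m)ᵀ) = g((δ^m), (m^δ), (m^δ))`
(`kronRect_eq_kroneckerCoeff_transpose`): the dimension of the `SL_m × SL_δ × SL_δ`-invariants of
degree `mδ` on `ℂ^m ⊗ ℂ^δ ⊗ ℂ^δ`. In THIS format the Christandl–Harrow–Mitchison semigroup property
(`ikenmeyerPanova2017_semigroup_holds`) splits the triple row-wise into smaller rectangle triples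
`((c^m), (a^δ), (a^δ))` with `mc = δa` (`kronRect_pos_of_split₂`), which is impossible in the
format `(δ^m)³` beyond the monoid `E(m)` itself. The generators with a two-column first shape,
`g((2^M), (b^δ), (b^δ))` (`2M = bδ`), are READ FROM THE TREE: Ikenmeyer–Panova 2017, Cor. 6.10
(`ikenmeyerPanova2017_cor_6_10_holds`, `= 1` iff `(δ - b) ∣ δ`, for `b ≠ δ`) and, for the square
`b = δ`, Sylvester's formula / one `S_16` class sum of the tree's Murnaghan–Nakayama evaluator.

## What is proved

* `kronRect_eq_kroneckerCoeff_transpose`, `kronRect_pos_of_parts`, `kronRect_pos_of_split₂`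
  (the transport of the semigroup property to `k_m(δ)` in the mixed format).
* Generators: `kroneckerCoeff_rect_eight_two_pos` (`g((2^8),(4^4),(4^4)) > 0`, `S_16` class sum;
  the value is `p_8(4,4) - p_7(4,4) = 1`), `kroneckerCoeff_rect_ten_two_eq_one`
  (`g((2^10),(4^5),(4^5)) = 1`, Cor. 6.10 with `(4-5) ∣ 4`), `kroneckerCoeff_rect_twelve_two_eq_one`
  (`g((2^12),(4^6),(4^6)) = 1`, Cor. 6.10 with `(4-6) ∣ 4`).
* **`kronRect_eight_four_pos : 0 < kronRect ℂ 8 4`** (`(4^8),(8^4),(8^4)` = twice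
  `(2^8),(4^4),(4^4)`) and **`kronRect_twelve_six_pos : 0 < kronRect ℂ 12 6`** (three times
  `(2^12),(4^6),(4^6)`): BI Ex. 5.6 "`4 ∈ E'(8)`", "`6 ∈ E'(12)`" — `thirtyTwo_mem_genericTensorDegreeMonoid_eight`,
  `seventyTwo_mem_genericTensorDegreeMonoid_twelve`.
* `kronRect_ten_five_pos_of`: `k_10(5) > 0` from the single `S_30` coefficient
  `g((3^10),(6^5),(6^5)) > 0` (value `5`; the other piece `g((2^10),(4^5),(4^5)) = 1` is free) —
  the `S_30` certificate itself is seat t08 g6's (`BI17KronRectMixedSplitting.lean`), not here.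

Honest framing: two of the fourteen positivity atoms of the shape clause of `BI2017_ex_5_6`
(`7 ≤ m ≤ 12`); no clause `m ∈ {7, …, 12}` closes here (the atoms `k_7(5), k_7(6), k_8(5), k_9(5),
k_10(7), k_11(5..7), k_12(5), k_12(7)` have `gcd(m, δ) = 1` and admit no split); the named fact stays
open. Nothing here bears on VP versus VNP, which is NOT proved.

## References
* [BurgisserIkenmeyer2017] P. Bürgisser, C. Ikenmeyer, J. Algebra 477 (2017), §5, Ex. 5.6
  (arXiv:1511.02927 p. 18).
* [IkenmeyerPanova2017] C. Ikenmeyer, G. Panova, Adv. Math. 319 (2017) 40–66, §1.1 (semigroup and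
  transposition properties), Cor. 6.10 (TeX L1486–1491).
* [PakPanova2014Unimodality] I. Pak, G. Panova, J. Algebraic Combin. 40 (2014), Lemma 1.3
  (Sylvester's formula `g(m^ℓ, m^ℓ, (n-k,k)) = p_k - p_{k-1}`).

## Mathlib and tree
Tree: `kronRect`, `genericTensorDegreeMonoid_eq_kronRect` (`BI17FundamentalInvariantTensors`,
`BI17SL3InvariantDimensionProofs`); `kroneckerCoeff_transpose` (`SymmetricGroupRepsSignTwist`);
`ikenmeyerPanova2017_semigroup_holds` (`OccurrenceObstructionsIPSemigroup`);
`ikenmeyerPanova2017_cor_6_10_holds` (`TwoRowTwoRectanglesKronecker`); `Nat.Partition.rowAdd`,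
`rowAdd_rectangle_parts`, `rowAdd_parts_congr`, `transpose_rectangle_parts`,
`kroneckerCoeff_congr_parts` (`OccurrenceObstructionsIP*`); `MNEval.kronSum`,
`kroneckerCoeff_pos_iff_kronSum_pos` (`SymmetricGroupCharacterEvaluation`). Mathlib:
`Nat.Partition`, `Multiset.replicate`.

Provenance: val-lit cell, literature-prover val-lit-t04 g6 (row BI2017-B; the splitting was found
independently by seat t08 g6, whose file carries the `S_30` pieces for `k_10(5), k_10(6)`).
-/

open Literature.NumberTheory.DiophantineGeometry (kroneckerCoeff kroneckerCoeff_transpose)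
open Literature.Computability.Complexity
open Literature.RepresentationTheory.FiniteGroups
open Literature.RepresentationTheory.FiniteGroups.MNEval

namespace Literature.Computability.AlgebraicComplexity

/-! ### 1. The mixed format `(δ^m), (m^δ), (m^δ)` and the transport of the semigroup property -/

section Transport

/-- **Mixed format**: `k_m(δ) = g((δ^m), (δ^m)ᵀ, (δ^m)ᵀ)` — the transposition property
`g(λ, μ, ν) = g(λ, μᵀ, νᵀ)` at three equal rectangles; `(δ^m)ᵀ = (m^δ)`.
[cite: IkenmeyerPanova2017, §1.1 (the transposition property)] -/
theorem kronRect_eq_kroneckerCoeff_transpose (m δ : ℕ) :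
    kronRect ℂ m δ = kroneckerCoeff ℂ (Nat.Partition.rectangle m δ)
      (Nat.Partition.rectangle m δ).transpose (Nat.Partition.rectangle m δ).transpose := by
  unfold kronRect
  exact kroneckerCoeff_transpose ℂ _ _ _

/-- **Transport**: if `(L, M, N)` has the parts of `((δ^m), (m^δ), (m^δ))` (in any written size)
and `g(L, M, N) > 0`, then `k_m(δ) > 0`. [cite: IkenmeyerPanova2017, §1.1 (the transposition property)] -/
theorem kronRect_pos_of_parts {m δ A : ℕ} {L M N : Nat.Partition A}
    (hL : L.parts = (Nat.Partition.rectangle m δ).parts)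
    (hM : M.parts = (Nat.Partition.rectangle δ m).parts)
    (hN : N.parts = (Nat.Partition.rectangle δ m).parts)
    (h : 0 < kroneckerCoeff ℂ L M N) : 0 < kronRect ℂ m δ := by
  have hA : m * δ = A := by
    have h1 := congrArg Multiset.sum hL
    rw [L.parts_sum, (Nat.Partition.rectangle m δ).parts_sum] at h1
    exact h1.symm
  rw [kronRect_eq_kroneckerCoeff_transpose,
    kroneckerCoeff_congr_parts hA hL.symm (by rw [transpose_rectangle_parts, hM])
      (by rw [transpose_rectangle_parts, hN])]
  exact h

/-- **Mixed-format splitting (two pieces)**: if `(l₁, m₁, n₁) ⊢ a` and `(l₂, m₂, n₂) ⊢ b` have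
positive Kronecker coefficients and their row-wise sums have the parts of `((δ^m), (m^δ), (m^δ))`,
then `k_m(δ) > 0` — the semigroup property (Christandl–Harrow–Mitchison; Ikenmeyer–Panova §1.1)
in the format `SL_m × SL_δ × SL_δ`. Typical use: `lᵢ = (cᵢ^m)`, `mᵢ = nᵢ = (aᵢ^δ)` with
`m cᵢ = δ aᵢ`, `c₁ + c₂ = δ`, `a₁ + a₂ = m`. [cite: IkenmeyerPanova2017, §1.1 (the semigroup property)] -/
theorem kronRect_pos_of_split₂ {m δ a b : ℕ} {l₁ m₁ n₁ : Nat.Partition a}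
    {l₂ m₂ n₂ : Nat.Partition b}
    (hl : (l₁.rowAdd l₂).parts = (Nat.Partition.rectangle m δ).parts)
    (hm : (m₁.rowAdd m₂).parts = (Nat.Partition.rectangle δ m).parts)
    (hn : (n₁.rowAdd n₂).parts = (Nat.Partition.rectangle δ m).parts)
    (h₁ : 0 < kroneckerCoeff ℂ l₁ m₁ n₁) (h₂ : 0 < kroneckerCoeff ℂ l₂ m₂ n₂) :
    0 < kronRect ℂ m δ :=
  kronRect_pos_of_parts hl hm hn (ikenmeyerPanova2017_semigroup_holds l₁ m₁ n₁ l₂ m₂ n₂ h₁ h₂)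

end Transport

/-! ### 2. Two-column generators `g((2^M), (b^δ), (b^δ))` -/

section Generators

/-- The parts of the rectangle `(b^a)` for `b ≠ 0`: `a` copies of `b`. [folklore] -/
private theorem parts_rectangle_of_ne_zero (a b : ℕ) (hb : b ≠ 0) :
    (Nat.Partition.rectangle a b).parts = Multiset.replicate a b := by
  rw [Nat.Partition.parts_rectangle, Multiset.filter_eq_self]
  intro x hx
  rwa [Multiset.eq_of_mem_replicate hx]

set_option maxHeartbeats 100000000 in
set_option maxRecDepth 100000 in
/-- **`g((2^8), (4^4), (4^4)) > 0`** (its value is `p_8(4,4) - p_7(4,4) = 8 - 7 = 1` by Sylvester's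
formula `g((δⁿ),(δⁿ),(nδ-k,k)) = p_k(n,δ) - p_{k-1}(n,δ)` and the transposition property; certified
here by one `S_16` class sum of the tree's Murnaghan–Nakayama evaluator).
[cite: PakPanova2014Unimodality, Lemma 1.3] -/
theorem kroneckerCoeff_rect_eight_two_pos :
    0 < kroneckerCoeff ℂ (Nat.Partition.rectangle 8 2) (Nat.Partition.rectangle 4 4)
      (Nat.Partition.rectangle 4 4) := by
  rw [kroneckerCoeff_pos_iff_kronSum_pos, Nat.Partition.sortedParts_rectangle 8 2 (by norm_num),
    Nat.Partition.sortedParts_rectangle 4 4 (by norm_num)]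
  decide +kernel

/-- **Ikenmeyer–Panova Cor. 6.10 at `(2^{10})`, `5 × 4`**: `g((2^{10}), (4^5), (4^5)) = 1`
(`2k = nd = 20`, `(d - n) = (4 - 5) ∣ 4`). [cite: IkenmeyerPanova2017, Cor. 6.10 (TeX L1486–1491)] -/
theorem kroneckerCoeff_rect_ten_two_eq_one :
    kroneckerCoeff ℂ (Nat.Partition.rectangle 10 2) (Nat.Partition.rectangle 5 4)
      (Nat.Partition.rectangle 5 4) = 1 := by
  have h := ikenmeyerPanova2017_cor_6_10_holds 5 4 10 (by norm_num) (by norm_num)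
    (Nat.Partition.rectangle 10 2)
    (by rw [parts_rectangle_of_ne_zero 10 2 (by norm_num)]; decide)
  rw [h, if_pos ⟨by norm_num, by decide⟩]

/-- **Ikenmeyer–Panova Cor. 6.10 at `(2^{12})`, `6 × 4`**: `g((2^{12}), (4^6), (4^6)) = 1`
(`2k = nd = 24`, `(d - n) = (4 - 6) ∣ 4`). [cite: IkenmeyerPanova2017, Cor. 6.10 (TeX L1486–1491)] -/
theorem kroneckerCoeff_rect_twelve_two_eq_one :
    kroneckerCoeff ℂ (Nat.Partition.rectangle 12 2) (Nat.Partition.rectangle 6 4)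
      (Nat.Partition.rectangle 6 4) = 1 := by
  have h := ikenmeyerPanova2017_cor_6_10_holds 6 4 12 (by norm_num) (by norm_num)
    (Nat.Partition.rectangle 12 2)
    (by rw [parts_rectangle_of_ne_zero 12 2 (by norm_num)]; decide)
  rw [h, if_pos ⟨by norm_num, by decide⟩]

end Generators

/-! ### 3. The atoms `k_8(4) > 0`, `k_12(6) > 0`, and `k_10(5) > 0` modulo one `S_30` coefficient -/

section Atoms

/-- **BI 2017 Ex. 5.6, "`4 ∈ E'(8)`": `k_8(4) > 0` — PROVED without any `S_32` computation**:
`((4^8), (8^4), (8^4)) = ((2^8), (4^4), (4^4)) + ((2^8), (4^4), (4^4))` row-wise in the mixed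
format, and `g((2^8), (4^4), (4^4)) = 1 > 0`. [cite: BurgisserIkenmeyer2017, Ex. 5.6] -/
theorem kronRect_eight_four_pos : 0 < kronRect ℂ 8 4 :=
  kronRect_pos_of_split₂ (rowAdd_rectangle_parts 8 2 2) (rowAdd_rectangle_parts 4 4 4)
    (rowAdd_rectangle_parts 4 4 4) kroneckerCoeff_rect_eight_two_pos
    kroneckerCoeff_rect_eight_two_pos

/-- **BI 2017 Ex. 5.6, "`6 ∈ E'(12)`": `k_12(6) > 0` — PROVED without any `S_72` (or `S_36`)
computation**: `((6^{12}), (12^6), (12^6))` is three times `((2^{12}), (4^6), (4^6))` row-wise in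
the mixed format, and `g((2^{12}), (4^6), (4^6)) = 1 > 0` (Ikenmeyer–Panova Cor. 6.10).
[cite: BurgisserIkenmeyer2017, Ex. 5.6] -/
theorem kronRect_twelve_six_pos : 0 < kronRect ℂ 12 6 := by
  have h1 : 0 < kroneckerCoeff ℂ (Nat.Partition.rectangle 12 2) (Nat.Partition.rectangle 6 4)
      (Nat.Partition.rectangle 6 4) := by
    rw [kroneckerCoeff_rect_twelve_two_eq_one]; exact Nat.one_pos
  have h2 := ikenmeyerPanova2017_semigroup_holds _ _ _ _ _ _ h1 h1
  refine kronRect_pos_of_split₂ (l₁ := (Nat.Partition.rectangle 12 2).rowAdd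
      (Nat.Partition.rectangle 12 2)) (l₂ := Nat.Partition.rectangle 12 2)
    (m₁ := (Nat.Partition.rectangle 6 4).rowAdd (Nat.Partition.rectangle 6 4))
    (m₂ := Nat.Partition.rectangle 6 4)
    (n₁ := (Nat.Partition.rectangle 6 4).rowAdd (Nat.Partition.rectangle 6 4))
    (n₂ := Nat.Partition.rectangle 6 4) ?_ ?_ ?_ h2 h1
  · rw [rowAdd_parts_congr (rowAdd_rectangle_parts 12 2 2) rfl]
    exact rowAdd_rectangle_parts 12 4 2
  · rw [rowAdd_parts_congr (rowAdd_rectangle_parts 6 4 4) rfl]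
    exact rowAdd_rectangle_parts 6 8 4
  · rw [rowAdd_parts_congr (rowAdd_rectangle_parts 6 4 4) rfl]
    exact rowAdd_rectangle_parts 6 8 4

/-- **`k_10(5) > 0` from ONE `S_30` coefficient**: `((5^{10}), (10^5), (10^5)) =
((2^{10}), (4^5), (4^5)) + ((3^{10}), (6^5), (6^5))` row-wise in the mixed format; the first piece
has `g = 1` (Ikenmeyer–Panova Cor. 6.10), so `g((3^{10}), (6^5), (6^5)) > 0` (its value is `5`, a
class sum over `S_30`) gives BI Ex. 5.6 "`5 ∈ E'(10)`". [cite: BurgisserIkenmeyer2017, Ex. 5.6] -/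
theorem kronRect_ten_five_pos_of
    (h30 : 0 < kroneckerCoeff ℂ (Nat.Partition.rectangle 10 3) (Nat.Partition.rectangle 5 6)
      (Nat.Partition.rectangle 5 6)) :
    0 < kronRect ℂ 10 5 := by
  have h1 : 0 < kroneckerCoeff ℂ (Nat.Partition.rectangle 10 2) (Nat.Partition.rectangle 5 4)
      (Nat.Partition.rectangle 5 4) := by
    rw [kroneckerCoeff_rect_ten_two_eq_one]; exact Nat.one_pos
  exact kronRect_pos_of_split₂ (rowAdd_rectangle_parts 10 2 3) (rowAdd_rectangle_parts 5 4 6)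
    (rowAdd_rectangle_parts 5 4 6) h1 h30

end Atoms

/-! ### 4. The degrees `32 ∈ E(8)` and `72 ∈ E(12)` -/

section Degrees

/-- **BI 2017 Ex. 5.6: `32 ∈ E(8)`** (`⊗³ℂ^8` has a non-zero `SL_8³`-invariant of degree `32`),
from `k_8(4) > 0` and `E(m) = {mδ : k_m(δ) > 0}`. [cite: BurgisserIkenmeyer2017, Ex. 5.6] -/
theorem thirtyTwo_mem_genericTensorDegreeMonoid_eight :
    32 ∈ genericTensorDegreeMonoid (Fin 8) ℂ := by
  rw [genericTensorDegreeMonoid_eq_kronRect]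
  exact ⟨4, by norm_num, kronRect_eight_four_pos⟩

/-- **BI 2017 Ex. 5.6: `72 ∈ E(12)`** (`⊗³ℂ^{12}` has a non-zero `SL_{12}³`-invariant of degree
`72`), from `k_12(6) > 0`. [cite: BurgisserIkenmeyer2017, Ex. 5.6] -/
theorem seventyTwo_mem_genericTensorDegreeMonoid_twelve :
    72 ∈ genericTensorDegreeMonoid (Fin 12) ℂ := by
  rw [genericTensorDegreeMonoid_eq_kronRect]
  exact ⟨6, by norm_num, kronRect_twelve_six_pos⟩

end Degrees

end Literature.Computability.AlgebraicComplexity
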